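import Mathlib
import Summits.NavierStokesRegularity.NavierStokesRegularity.Theorems.CertifiedBlowupCertifiedBlowupAxisymBlowupEnergyDrain
import Literature.Analysis.FluidPDE.LimitLerayHopf
import HarnessLib

/-!
# `RootDecompLitSlice` — the TIME-SIDE toolkit of the mean-field one-step
# (helpers toward `CritTameScarIsCritical`, stmt-NavierStokesRegularity-31733)

Sixth helper file of the mean-field lever (cell `decomp-ns`, gen 43; companion of
`RootDecompLitSliceMeanFieldTrilinear.lean`, the slice term bounds). The one-step antecedent `hstep`
of `RootDecompLitSliceMeanFieldBootstrap.lean` (p837180) is assembled from slice term bounds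
integrated over the window `(t, T)` against a FIXED proxy slice `ū = u(s)`; this file supplies the
two time-side inputs of that assembly (blueprint B3 and B7 of the cell tree), in the dissipation
currency `∫⁻ τ in Ioo t T, ∫⁻ x, ENNReal.ofReal (frobeniusNormSq (fderiv ℝ (u τ) x))` of the tree
(`EnergyDrain.dissipation_le_energy_sub`, `EnergyClockScarLaw.energyDrop_eq_dissipation_of_tame`):

* B3, the CHEBYSHEV PROXY SLICE `exists_slice_dissipation_le`: for a classical solution on
  `[0,T) × ℝ³`, Leray–Hopf on `[0,T]`, and `0 < σ ≤ T`, some `s ∈ (T − σ, T − σ/2)` has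
  `∫ |∇u(s)|²_F ≤ (E(T−σ) − E(T)) / (ν σ)`, `E(t) = ∫ ‖u(t)‖²` — the proxy `ū = u(s)` whose gradient is
  paid by the energy drop `D(T − σ)` alone (first-moment method + the energy inequality restarted at
  `T − σ`; no tameness needed);
* B7, the WINDOW POWER MEANS `windowDissipation_rpow_le(_energyDrop)`: for `t ∈ [0,T)`, `0 < θ < 1`,
  `∫_t^T (∫|∇u(τ)|²_F)^θ dτ ≤ (T − t)^{1−θ} (∫_t^T∫|∇u|²_F)^θ ≤ (T − t)^{1−θ} ((E(t) − E(T))/(2ν))^θ`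
  (Hölder in time against `1`; `θ = 1/2` serves the viscous cross term, `θ = 3/4` the transport term).

Supporting lemmas (all PROVED, def-free, standard axioms): the generic power mean on a set
`setLIntegral_rpow_le`, the interval Chebyshev slice `exists_mem_Ioo_le_lintegral_div`, a.e.-measurability
of the slice dissipation on windows of `[0,T)` (`aemeasurable_sliceDissipation(_top)`, from the tree's
`aemeasurable_lintegral_frobeniusNormSq` and exhaustion `aemeasurable_restrict_Ioo_of_forall_lt`), and the
energy-drop bounds `windowDissipation_le`, `energy_antitone` (repackaging `dissipation_le_energy_sub` in the
`∫ ‖u‖²` currency).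

References: J. Leray, Acta Math. 63 (1934) §§27–34 [Leray1934]; J. C. Robinson, J. L. Rodrigo,
W. Sadowski, *The three-dimensional Navier–Stokes equations* (2016), Def. 4.9, Cor. 4.8, Thm. 8.13
[RobinsonRodrigoSadowski2016].
-/

set_option linter.dupNamespace false

namespace Summit.NavierStokesRegularity.NavierStokesRegularity.Theorems

open MeasureTheory Set Filter Topology
open scoped ENNReal NNReal
open Literature.Analysis.FluidPDE

namespace MeanFieldTimeSide

/-- **Power mean on a set** (Hölder against the constant `1`): for `0 < θ < 1` and `F`
a.e.-measurable on `s`, `∫_s F^θ ≤ μ(s)^{1−θ} (∫_s F)^θ`. [folklore] -/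
theorem setLIntegral_rpow_le {α : Type*} [MeasurableSpace α] {μ : Measure α} {F : α → ℝ≥0∞}
    {s : Set α} {θ : ℝ} (hθ0 : 0 < θ) (hθ1 : θ < 1) (hF : AEMeasurable F (μ.restrict s)) :
    ∫⁻ x in s, F x ^ θ ∂μ ≤ μ s ^ (1 - θ) * (∫⁻ x in s, F x ∂μ) ^ θ := by
  have hpq : (1 / (1 - θ)).HolderConjugate (1 / θ) :=
    ⟨by rw [one_div, one_div, inv_inv, inv_inv, inv_one]; ring, by positivity [sub_pos.2 hθ1],
      by positivity⟩
  have h := ENNReal.lintegral_mul_le_Lp_mul_Lq (μ.restrict s) hpq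
    (f := fun _ => (1 : ℝ≥0∞)) (g := fun x => F x ^ θ) aemeasurable_const (hF.pow_const θ)
  have hθne : θ ≠ 0 := hθ0.ne'
  simp only [Pi.mul_apply, one_mul, ENNReal.one_rpow, lintegral_const, Measure.restrict_apply_univ,
    one_div, inv_inv] at h
  refine h.trans (le_of_eq ?_)
  congr 2
  refine lintegral_congr fun x => ?_
  rw [← ENNReal.rpow_mul, mul_inv_cancel₀ hθne, ENNReal.rpow_one]

/-- **Chebyshev slice on an interval**: an a.e.-measurable `F ≥ 0` on `(a, b)` takes, at some
`s ∈ (a, b)`, a value at most its mean `(b − a)⁻¹ ∫_a^b F` (first-moment method,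
Mathlib `exists_le_setLAverage`). [folklore] -/
theorem exists_mem_Ioo_le_lintegral_div {F : ℝ → ℝ≥0∞} {a b : ℝ} (hab : a < b)
    (hF : AEMeasurable F (volume.restrict (Ioo a b))) :
    ∃ s ∈ Ioo a b, F s ≤ (∫⁻ x in Ioo a b, F x) / ENNReal.ofReal (b - a) := by
  have hvol : volume (Ioo a b) = ENNReal.ofReal (b - a) := Real.volume_Ioo
  have hne : volume (Ioo a b) ≠ 0 := by rw [hvol]; exact (ENNReal.ofReal_pos.2 (sub_pos.2 hab)).ne'
  have htop : volume (Ioo a b) ≠ ⊤ := by rw [hvol]; exact ENNReal.ofReal_ne_top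
  obtain ⟨s, hs, hle⟩ := exists_le_setLAverage hne htop hF
  exact ⟨s, hs, hle.trans_eq (by rw [setLAverage_eq, hvol])⟩

/-- A.e.-measurability on an open interval `(a, b)` from a.e.-measurability on the subintervals
`(a, b')`, `b' < b` (exhaustion along a sequence `b_n ↑ b`). [folklore] -/
theorem aemeasurable_restrict_Ioo_of_forall_lt {F : ℝ → ℝ≥0∞} {a b : ℝ}
    (h : ∀ b' < b, AEMeasurable F (volume.restrict (Ioo a b'))) :
    AEMeasurable F (volume.restrict (Ioo a b)) := by
  obtain ⟨c, hc_mono, hc_lt, hc_tendsto⟩ := exists_seq_strictMono_tendsto b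
  have hU : Ioo a b = ⋃ n, Ioo a (c n) := by
    apply Subset.antisymm
    · intro x hx
      obtain ⟨n, hn⟩ := (hc_tendsto.eventually (eventually_gt_nhds hx.2)).exists
      exact mem_iUnion.2 ⟨n, hx.1, hn⟩
    · exact iUnion_subset fun n => Ioo_subset_Ioo_right (hc_lt n).le
  rw [hU]
  exact aemeasurable_iUnion_iff.2 fun n => h (c n) (hc_lt n)

section NS

variable {ν T : ℝ} {u : ℝ → EuclideanSpace ℝ (Fin 3) → EuclideanSpace ℝ (Fin 3)}
  {p : ℝ → EuclideanSpace ℝ (Fin 3) → ℝ}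

/-- **The slice dissipation of a classical solution on `[0,T)` is a.e.-measurable on every window
`(a, b)` with `0 ≤ a`, `b < T`** (joint continuity of `∇u` on `[0, b] × ℝ³`, Tonelli;
`aemeasurable_lintegral_frobeniusNormSq`). [folklore] -/
theorem aemeasurable_sliceDissipation (hcl : IsClassicalNSSolutionOn (Ico 0 T) ν 0 u p) {a b : ℝ}
    (ha : 0 ≤ a) (hb : b < T) :
    AEMeasurable (fun τ => ∫⁻ x, ENNReal.ofReal (frobeniusNormSq (fderiv ℝ (u τ) x)))
      (volume.restrict (Ioo a b)) := by
  rcases le_or_gt b a with hba | hab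
  · rw [Ioo_eq_empty (not_lt.2 hba), Measure.restrict_empty]
    exact aemeasurable_zero_measure
  have hb0 : 0 < b := ha.trans_lt hab
  have hcl' : IsClassicalNSSolutionOn (Icc 0 b) ν 0 u p :=
    hcl.mono (fun t ht => ⟨ht.1, ht.2.trans_lt hb⟩) (uniqueDiffOn_Icc hb0)
  exact aemeasurable_lintegral_frobeniusNormSq hb0 hcl' ha le_rfl

/-- The same up to the final time: a.e.-measurability on `(a, T)`, `0 ≤ a` (exhaustion by
`(a, b)`, `b ↑ T`). [folklore] -/
theorem aemeasurable_sliceDissipation_top (hcl : IsClassicalNSSolutionOn (Ico 0 T) ν 0 u p) {a : ℝ}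
    (ha : 0 ≤ a) :
    AEMeasurable (fun τ => ∫⁻ x, ENNReal.ofReal (frobeniusNormSq (fderiv ℝ (u τ) x)))
      (volume.restrict (Ioo a T)) :=
  aemeasurable_restrict_Ioo_of_forall_lt fun _ hb => aemeasurable_sliceDissipation hcl ha hb

/-- **Window dissipation is paid by the energy drop** (Leray–Hopf energy inequality restarted at
`t₁`, `EnergyDrain.dissipation_le_energy_sub`), in the `∫ ‖u‖²` currency:
`∫_{t₁}^{t₂} ∫ |∇u|²_F ≤ (E(t₁) − E(t₂)) / (2ν)` as an `ℝ≥0∞` bound, `E(t) = ∫ ‖u(t)‖²`. [folklore] -/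
theorem windowDissipation_le (hν : 0 < ν) (hcl : IsClassicalNSSolutionOn (Ico 0 T) ν 0 u p)
    (hLH : IsLerayHopfOn T ν 0 (u 0) u) {t₁ t₂ : ℝ} (ht₁ : 0 ≤ t₁) (h12 : t₁ ≤ t₂) (ht₂ : t₂ ≤ T) :
    (∫⁻ τ in Ioo t₁ t₂, ∫⁻ x, ENNReal.ofReal (frobeniusNormSq (fderiv ℝ (u τ) x))) ≤
      ENNReal.ofReal (((∫ x, ‖u t₁ x‖ ^ 2) - ∫ x, ‖u t₂ x‖ ^ 2) / (2 * ν)) := by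
  obtain ⟨hfin, hle⟩ :=
    CertifiedBlowupAxisymBlowup.EnergyDrain.dissipation_le_energy_sub hν hcl hLH ht₁ h12 ht₂
  have hKE : ∀ v : EuclideanSpace ℝ (Fin 3) → EuclideanSpace ℝ (Fin 3),
      VectorCalculus.kineticEnergy v = 2⁻¹ * ∫ x, ‖v x‖ ^ 2 := fun v => by
    simp only [VectorCalculus.kineticEnergy]
  rw [hKE, hKE] at hle
  rw [← ENNReal.ofReal_toReal hfin]
  refine ENNReal.ofReal_le_ofReal ?_
  rw [le_div_iff₀ (by positivity)]
  linarith

/-- The energy is non-increasing across a window: `E(t₂) ≤ E(t₁)` for `0 ≤ t₁ ≤ t₂ ≤ T`. [folklore] -/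
theorem energy_antitone (hν : 0 < ν) (hcl : IsClassicalNSSolutionOn (Ico 0 T) ν 0 u p)
    (hLH : IsLerayHopfOn T ν 0 (u 0) u) {t₁ t₂ : ℝ} (ht₁ : 0 ≤ t₁) (h12 : t₁ ≤ t₂) (ht₂ : t₂ ≤ T) :
    ∫ x, ‖u t₂ x‖ ^ 2 ≤ ∫ x, ‖u t₁ x‖ ^ 2 := by
  obtain ⟨-, hle⟩ :=
    CertifiedBlowupAxisymBlowup.EnergyDrain.dissipation_le_energy_sub hν hcl hLH ht₁ h12 ht₂
  have hKE : ∀ v : EuclideanSpace ℝ (Fin 3) → EuclideanSpace ℝ (Fin 3),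
      VectorCalculus.kineticEnergy v = 2⁻¹ * ∫ x, ‖v x‖ ^ 2 := fun v => by
    simp only [VectorCalculus.kineticEnergy]
  rw [hKE, hKE] at hle
  have h0 : 0 ≤ ν * (∫⁻ τ in Ioo t₁ t₂, ∫⁻ x, ENNReal.ofReal (frobeniusNormSq (fderiv ℝ (u τ) x))).toReal :=
    mul_nonneg hν.le ENNReal.toReal_nonneg
  linarith

/-- **Chebyshev slice of the dissipation (blueprint B3).** For a classical solution on `[0,T) × ℝ³`,
Leray–Hopf on `[0,T]` from `u 0`, and a window size `0 < σ ≤ T`, some slice `s ∈ (T − σ, T − σ/2)`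
has dissipation at most the window mean: `∫ |∇u(s)|²_F ≤ (E(T−σ) − E(T)) / (ν σ)`,
`E(t) = ∫ ‖u(t)‖²` — the «good proxy slice» `ū = u(s)` of the mean-field one-step, with `‖∇ū‖₂²`
controlled by the energy drop `D(T − σ)` alone. [folklore] -/
theorem exists_slice_dissipation_le (hν : 0 < ν) (hT : 0 < T)
    (hcl : IsClassicalNSSolutionOn (Ico 0 T) ν 0 u p) (hLH : IsLerayHopfOn T ν 0 (u 0) u)
    {σ : ℝ} (hσ : 0 < σ) (hσT : σ ≤ T) :
    ∃ s ∈ Ioo (T - σ) (T - σ / 2),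
      (∫⁻ x, ENNReal.ofReal (frobeniusNormSq (fderiv ℝ (u s) x))) ≤
        ENNReal.ofReal ((((∫ x, ‖u (T - σ) x‖ ^ 2) - ∫ x, ‖u T x‖ ^ 2)) / (ν * σ)) := by
  set F : ℝ → ℝ≥0∞ := fun τ => ∫⁻ x, ENNReal.ofReal (frobeniusNormSq (fderiv ℝ (u τ) x)) with hF
  have h0 : 0 ≤ T - σ := sub_nonneg.2 hσT
  have hab : T - σ < T - σ / 2 := by linarith
  have hbT : T - σ / 2 < T := by linarith
  have hmeas : AEMeasurable F (volume.restrict (Ioo (T - σ) (T - σ / 2))) :=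
    aemeasurable_sliceDissipation hcl h0 hbT
  obtain ⟨s, hs, hle⟩ := exists_mem_Ioo_le_lintegral_div hab hmeas
  refine ⟨s, hs, hle.trans ?_⟩
  have hW := windowDissipation_le hν hcl hLH h0 hab.le hbT.le
  have hE := energy_antitone hν hcl hLH (by linarith) hbT.le le_rfl
  have hlen : T - σ / 2 - (T - σ) = σ / 2 := by ring
  rw [hlen]
  calc (∫⁻ x in Ioo (T - σ) (T - σ / 2), F x) / ENNReal.ofReal (σ / 2)
      ≤ ENNReal.ofReal (((∫ x, ‖u (T - σ) x‖ ^ 2) - ∫ x, ‖u (T - σ / 2) x‖ ^ 2) / (2 * ν)) /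
          ENNReal.ofReal (σ / 2) := by gcongr
    _ ≤ ENNReal.ofReal (((∫ x, ‖u (T - σ) x‖ ^ 2) - ∫ x, ‖u T x‖ ^ 2) / (2 * ν)) /
          ENNReal.ofReal (σ / 2) := by gcongr
    _ = ENNReal.ofReal ((((∫ x, ‖u (T - σ) x‖ ^ 2) - ∫ x, ‖u T x‖ ^ 2)) / (ν * σ)) := by
        rw [← ENNReal.ofReal_div_of_pos (by positivity)]
        congr 1
        field_simp

/-- **Window power means of the dissipation (blueprint B7).** For `t ∈ [0, T)` and `0 < θ < 1`,
`∫_t^T (∫|∇u(τ)|²_F)^θ dτ ≤ (T − t)^{1−θ} (∫_t^T ∫|∇u|²_F)^θ` (Hölder in time against `1`; used with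
`θ = 1/2` for the viscous cross term and `θ = 3/4` for the transport term). [folklore] -/
theorem windowDissipation_rpow_le (hcl : IsClassicalNSSolutionOn (Ico 0 T) ν 0 u p) {t : ℝ}
    (ht : t ∈ Ico 0 T) {θ : ℝ} (hθ0 : 0 < θ) (hθ1 : θ < 1) :
    (∫⁻ τ in Ioo t T, (∫⁻ x, ENNReal.ofReal (frobeniusNormSq (fderiv ℝ (u τ) x))) ^ θ) ≤
      ENNReal.ofReal (T - t) ^ (1 - θ) *
        (∫⁻ τ in Ioo t T, ∫⁻ x, ENNReal.ofReal (frobeniusNormSq (fderiv ℝ (u τ) x))) ^ θ := by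
  have h := setLIntegral_rpow_le (μ := volume) hθ0 hθ1 (aemeasurable_sliceDissipation_top hcl ht.1)
  rwa [Real.volume_Ioo] at h

/-- The two power means combined with the energy drop: for `t ∈ [0,T)`, `0 < θ < 1`,
`∫_t^T (∫|∇u(τ)|²_F)^θ dτ ≤ (T − t)^{1−θ} ((E(t) − E(T)) / (2ν))^θ`. [folklore] -/
theorem windowDissipation_rpow_le_energyDrop (hν : 0 < ν)
    (hcl : IsClassicalNSSolutionOn (Ico 0 T) ν 0 u p) (hLH : IsLerayHopfOn T ν 0 (u 0) u) {t : ℝ}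
    (ht : t ∈ Ico 0 T) {θ : ℝ} (hθ0 : 0 < θ) (hθ1 : θ < 1) :
    (∫⁻ τ in Ioo t T, (∫⁻ x, ENNReal.ofReal (frobeniusNormSq (fderiv ℝ (u τ) x))) ^ θ) ≤
      ENNReal.ofReal (T - t) ^ (1 - θ) *
        ENNReal.ofReal (((∫ x, ‖u t x‖ ^ 2) - ∫ x, ‖u T x‖ ^ 2) / (2 * ν)) ^ θ := by
  refine (windowDissipation_rpow_le hcl ht hθ0 hθ1).trans ?_
  gcongr
  exact windowDissipation_le hν hcl hLH ht.1 ht.2.le le_rfl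

end NS

end MeanFieldTimeSide

end Summit.NavierStokesRegularity.NavierStokesRegularity.Theorems
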